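import Summits.HubbardSuperconductivity.HubbardSuperconductivity.Theorems.NodalWardXYVisonPairCostDefs

/-!
# `RankWindow` for the line `Sketch` of the crux `NodalWardXY.VisonPairCost`

`|D_t − D_a| ≤ 8R log(a/t)` (`0 < t ≤ a`): `rank(N_R − N_0) ≤ 4R` (support on the string orbitals),
the eigenvalue counting functions of symmetric `S, T` differ by `≤ rank(S − T)` (dimension counting),
hence `|Σᵢ φ(λᵢ(S)) − Σᵢ φ(λᵢ(T))| ≤ rank·osc(φ)` for monotone bounded `φ`, applied to the monotone and
antitone parts of `log((λ²+t²)/(λ²+a²))` after `log‖det(A+it)‖ = ½Σᵢ log(λᵢ²+t²)`.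
-/

noncomputable section

-- tree namespace Summit.HubbardSuperconductivity.HubbardSuperconductivity (D-0017)
set_option linter.dupNamespace false

namespace Summit.HubbardSuperconductivity.HubbardSuperconductivity.Theorems.VisonPairCost

open Literature.Probability.LatticeModels Literature.MathematicalPhysics.QuantumLattice
open Module Finset
open scoped InnerProductSpace Matrix ComplexConjugate

/-! ### Eigenvalue counting for finite-rank perturbations of symmetric operators -/

section Counting

variable {E : Type*} [NormedAddCommGroup E] [InnerProductSpace ℂ E] [FiniteDimensional ℂ E] {n : ℕ}

/-- Rayleigh expansion `⟪v, Tv⟫ = Σᵢ λᵢ |⟪bᵢ, v⟫|²` in the eigenvector basis. -/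
theorem inner_self_apply_eq {T : E →ₗ[ℂ] E} (hT : T.IsSymmetric) (hn : finrank ℂ E = n) (v : E) :
    ⟪v, T v⟫_ℂ = ((∑ i, hT.eigenvalues hn i * ‖⟪hT.eigenvectorBasis hn i, v⟫_ℂ‖ ^ 2 : ℝ) : ℂ) := by
  rw [← (hT.eigenvectorBasis hn).sum_inner_mul_inner v (T v), Complex.ofReal_sum]
  refine sum_congr rfl fun i _ => ?_
  rw [← hT (hT.eigenvectorBasis hn i) v, hT.apply_eigenvectorBasis, inner_smul_left,
    RCLike.conj_ofReal, ← inner_conj_symm v (hT.eigenvectorBasis hn i)]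
  push_cast
  rw [← Complex.conj_mul']
  simp only [RCLike.ofReal_eq_complex_ofReal]
  ring

omit [FiniteDimensional ℂ E] in
/-- In the span of the basis vectors `bᵢ`, `i ∈ I`, the coefficients outside `I` vanish. -/
theorem inner_eq_zero_of_mem_span (b : OrthonormalBasis (Fin n) ℂ E) (I : Finset (Fin n)) {v : E}
    (hv : v ∈ Submodule.span ℂ (Set.range fun i : I => b i)) {k : Fin n} (hk : k ∉ I) :
    ⟪b k, v⟫_ℂ = 0 := by
  obtain ⟨c, rfl⟩ := (Submodule.mem_span_range_iff_exists_fun ℂ).mp hv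
  rw [inner_sum]
  refine sum_eq_zero fun i _ => ?_
  rw [inner_smul_right, orthonormal_iff_ite.mp b.orthonormal, if_neg, mul_zero]
  rintro rfl
  exact hk i.2

/-- **Eigenvalue counting under a finite-rank perturbation**: for symmetric `S`, `T` and real `c`,
`#{i : c ≤ λᵢ(S)} ≤ #{i : c ≤ λᵢ(T)} + rank(S − T)` (the `S`-eigenvectors with `λ ≥ c`, the
`T`-eigenvectors with `λ < c` and `ker(S − T)` would otherwise share a nonzero vector). -/
theorem card_filter_le_eigenvalues_le {S T : E →ₗ[ℂ] E} (hS : S.IsSymmetric) (hT : T.IsSymmetric)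
    (hn : finrank ℂ E = n) (c : ℝ) :
    (univ.filter fun i => c ≤ hS.eigenvalues hn i).card ≤
      (univ.filter fun i => c ≤ hT.eigenvalues hn i).card +
        finrank ℂ (LinearMap.range (S - T)) := by
  set I := univ.filter fun i => c ≤ hS.eigenvalues hn i
  set J := univ.filter fun i => ¬ c ≤ hT.eigenvalues hn i
  set U := Submodule.span ℂ (Set.range fun i : I => hS.eigenvectorBasis hn i)
  set W := Submodule.span ℂ (Set.range fun i : J => hT.eigenvectorBasis hn i)
  set K := LinearMap.ker (S - T)
  have hU : finrank ℂ U = I.card := (Fintype.card_coe I) ▸ finrank_span_eq_card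
    ((hS.eigenvectorBasis hn).orthonormal.linearIndependent.comp _ Subtype.val_injective)
  have hW : finrank ℂ W = J.card := (Fintype.card_coe J) ▸ finrank_span_eq_card
    ((hT.eigenvectorBasis hn).orthonormal.linearIndependent.comp _ Subtype.val_injective)
  have hK : finrank ℂ (LinearMap.range (S - T)) + finrank ℂ K = n := by
    rw [LinearMap.finrank_range_add_finrank_ker, hn]
  have hIJ : (univ.filter fun i => c ≤ hT.eigenvalues hn i).card + J.card = n := by
    rw [card_filter_add_card_filter_not, card_univ, Fintype.card_fin]
  have h1 := Submodule.finrank_sup_add_finrank_inf_eq U W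
  have h2 := Submodule.finrank_sup_add_finrank_inf_eq (U ⊓ W) K
  have h3 : finrank ℂ ↥(U ⊔ W) ≤ n := hn ▸ Submodule.finrank_le _
  have h4 : finrank ℂ ↥(U ⊓ W ⊔ K) ≤ n := hn ▸ Submodule.finrank_le _
  by_contra hlt
  have hpos : 0 < finrank ℂ ↥(U ⊓ W ⊓ K) := by omega
  have hne : U ⊓ W ⊓ K ≠ ⊥ := fun h => by rw [h, finrank_bot] at hpos; exact lt_irrefl _ hpos
  obtain ⟨v, hv, hv0⟩ := Submodule.exists_mem_ne_zero_of_ne_bot hne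
  have hvU := (Submodule.mem_inf.mp (Submodule.mem_inf.mp hv).1).1
  have hvW := (Submodule.mem_inf.mp (Submodule.mem_inf.mp hv).1).2
  have hST : S v = T v := sub_eq_zero.mp (LinearMap.mem_ker.mp (Submodule.mem_inf.mp hv).2)
  have hkey : ∑ i, hS.eigenvalues hn i * ‖⟪hS.eigenvectorBasis hn i, v⟫_ℂ‖ ^ 2 =
      ∑ i, hT.eigenvalues hn i * ‖⟪hT.eigenvectorBasis hn i, v⟫_ℂ‖ ^ 2 := by
    have h := inner_self_apply_eq hS hn v
    rw [hST, inner_self_apply_eq hT hn v] at h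
    exact_mod_cast h.symm
  have hlow : c * ‖v‖ ^ 2 ≤ ∑ i, hS.eigenvalues hn i * ‖⟪hS.eigenvectorBasis hn i, v⟫_ℂ‖ ^ 2 := by
    rw [← (hS.eigenvectorBasis hn).sum_sq_norm_inner_right v, mul_sum]
    refine sum_le_sum fun i _ => ?_
    by_cases hi : i ∈ I
    · exact mul_le_mul_of_nonneg_right (mem_filter.mp hi).2 (sq_nonneg _)
    · rw [inner_eq_zero_of_mem_span _ I hvU hi, norm_zero]; simp
  have hup : ∑ i, hT.eigenvalues hn i * ‖⟪hT.eigenvectorBasis hn i, v⟫_ℂ‖ ^ 2 < c * ‖v‖ ^ 2 := by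
    rw [← (hT.eigenvectorBasis hn).sum_sq_norm_inner_right v, mul_sum]
    obtain ⟨k, hk⟩ : ∃ k, ⟪hT.eigenvectorBasis hn k, v⟫_ℂ ≠ 0 := by
      by_contra! h
      exact hv0 (by rw [← (hT.eigenvectorBasis hn).sum_repr' v]; simp [h])
    have hkJ : k ∈ J := by
      by_contra hkJ
      exact hk (inner_eq_zero_of_mem_span _ J hvW hkJ)
    refine sum_lt_sum (fun i _ => ?_) ⟨k, mem_univ _, ?_⟩
    · by_cases hi : i ∈ J
      · exact mul_le_mul_of_nonneg_right (le_of_lt (not_le.mp (mem_filter.mp hi).2)) (sq_nonneg _)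
      · rw [inner_eq_zero_of_mem_span _ J hvW hi, norm_zero]; simp
    · exact mul_lt_mul_of_pos_right (not_le.mp (mem_filter.mp hkJ).2) (by positivity)
  rw [hkey] at hlow
  exact absurd (hlow.trans_lt hup) (lt_irrefl _)

/-- **Weyl interlacing under a rank-`r` perturbation** (decreasing order): `λ_{j+r}(S) ≤ λ_j(T)`. -/
theorem eigenvalues_add_le {S T : E →ₗ[ℂ] E} (hS : S.IsSymmetric) (hT : T.IsSymmetric)
    (hn : finrank ℂ E = n) {r : ℕ} (hr : finrank ℂ (LinearMap.range (S - T)) ≤ r) (j : Fin n)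
    (hj : (j : ℕ) + r < n) : hS.eigenvalues hn ⟨j + r, hj⟩ ≤ hT.eigenvalues hn j := by
  by_contra! hlt
  set c := hS.eigenvalues hn ⟨j + r, hj⟩
  have h := card_filter_le_eigenvalues_le hS hT hn c
  have hA : (j : ℕ) + r + 1 ≤ (univ.filter fun i => c ≤ hS.eigenvalues hn i).card := by
    calc (j : ℕ) + r + 1 = (Iic (⟨j + r, hj⟩ : Fin n)).card := by simp
      _ ≤ _ := card_le_card fun i hi =>
          mem_filter.mpr ⟨mem_univ _, hS.eigenvalues_antitone hn (mem_Iic.mp hi)⟩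
  have hB : (univ.filter fun i => c ≤ hT.eigenvalues hn i).card ≤ j := by
    calc _ ≤ (Iio j).card := card_le_card fun i hi => ?_
      _ = j := by simp
    rw [mem_Iio]
    by_contra! hij
    exact absurd ((mem_filter.mp hi).2.trans (hT.eigenvalues_antitone hn hij)) (not_le.mpr hlt)
  omega

/-- Shifted domination `x_{j+r} ≤ y_j` gives `Σ_{j<N} φ(x_j) ≤ Σ_{j<N} φ(y_j) + rV` for monotone `φ`
with values in `[0, V]`. -/
theorem sum_le_sum_add_of_shift {N r : ℕ} (x y : ℕ → ℝ) {φ : ℝ → ℝ} (hφ : Monotone φ) {V : ℝ}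
    (h0 : ∀ s, 0 ≤ φ s) (hV : ∀ s, φ s ≤ V) (hxy : ∀ j, j + r < N → x (j + r) ≤ y j) :
    ∑ j ∈ range N, φ (x j) ≤ ∑ j ∈ range N, φ (y j) + r * V := by
  rcases le_or_gt N r with hNr | hrN
  · calc ∑ j ∈ range N, φ (x j) ≤ ∑ j ∈ range N, (φ (y j) + V) :=
          sum_le_sum fun j _ => by linarith [hV (x j), h0 (y j)]
      _ = ∑ j ∈ range N, φ (y j) + N * V := by
          rw [sum_add_distrib, sum_const, card_range, nsmul_eq_mul]
      _ ≤ _ := by have hV0 : 0 ≤ V := (h0 0).trans (hV 0); gcongr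
  · obtain ⟨M, rfl⟩ : ∃ M, N = r + M := ⟨N - r, by omega⟩
    have hy : ∑ j ∈ range (r + M), φ (y j) =
        ∑ j ∈ range M, φ (y j) + ∑ j ∈ range r, φ (y (M + j)) := by
      rw [add_comm r M, sum_range_add]
    have e1 : ∑ j ∈ range r, φ (x j) ≤ r * V := by
      refine (sum_le_sum fun j _ => hV (x j)).trans ?_
      rw [sum_const, card_range, nsmul_eq_mul]
    have e2 : ∑ j ∈ range M, φ (x (r + j)) ≤ ∑ j ∈ range M, φ (y j) :=
      sum_le_sum fun j hj => hφ (by rw [add_comm]; exact hxy j (by rw [mem_range] at hj; omega))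
    have e3 : 0 ≤ ∑ j ∈ range r, φ (y (M + j)) := sum_nonneg fun j _ => h0 _
    rw [sum_range_add, hy]
    linarith

/-- **Spectral shift bound for monotone bounded functions**: if `rank(S − T) ≤ r` and `φ` is
monotone with values in `[0, V]`, then `|Σᵢ φ(λᵢ(S)) − Σᵢ φ(λᵢ(T))| ≤ rV`. -/
theorem abs_sum_eigenvalues_sub_le {S T : E →ₗ[ℂ] E} (hS : S.IsSymmetric) (hT : T.IsSymmetric)
    (hn : finrank ℂ E = n) {r : ℕ} (hr : finrank ℂ (LinearMap.range (S - T)) ≤ r) {φ : ℝ → ℝ}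
    (hφ : Monotone φ) {V : ℝ} (h0 : ∀ s, 0 ≤ φ s) (hV : ∀ s, φ s ≤ V) :
    |∑ i, φ (hS.eigenvalues hn i) - ∑ i, φ (hT.eigenvalues hn i)| ≤ r * V := by
  suffices key : ∀ {S T : E →ₗ[ℂ] E} (hS : S.IsSymmetric) (hT : T.IsSymmetric),
      finrank ℂ (LinearMap.range (S - T)) ≤ r →
        ∑ i, φ (hS.eigenvalues hn i) ≤ ∑ i, φ (hT.eigenvalues hn i) + r * V by
    have hr' : finrank ℂ (LinearMap.range (T - S)) ≤ r := by rwa [← neg_sub, LinearMap.range_neg]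
    rw [abs_sub_le_iff, sub_le_iff_le_add', sub_le_iff_le_add']
    exact ⟨key hS hT hr, key hT hS hr'⟩
  intro S T hS hT hr
  set x : ℕ → ℝ := fun j => if h : j < n then hS.eigenvalues hn ⟨j, h⟩ else 0
  set y : ℕ → ℝ := fun j => if h : j < n then hT.eigenvalues hn ⟨j, h⟩ else 0
  have hx : ∑ i, φ (hS.eigenvalues hn i) = ∑ j ∈ range n, φ (x j) := by
    rw [← Fin.sum_univ_eq_sum_range (fun j => φ (x j))]; simp [x]
  have hy : ∑ i, φ (hT.eigenvalues hn i) = ∑ j ∈ range n, φ (y j) := by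
    rw [← Fin.sum_univ_eq_sum_range (fun j => φ (y j))]; simp [y]
  rw [hx, hy]
  refine sum_le_sum_add_of_shift x y hφ h0 hV fun j hj => ?_
  simp only [x, y, dif_pos hj, dif_pos (show j < n by omega)]
  exact eigenvalues_add_le hS hT hn hr ⟨j, by omega⟩ hj

end Counting

/-! ### Hermitian matrices: the log-determinant kernel -/

section MatrixLevel

variable {m : Type*} [Fintype m] [DecidableEq m]

/-- `det(A + c) = Πᵢ (λᵢ(A) + c)` for Hermitian `A` (spectral theorem). -/
theorem det_add_smul_one_eq {A : Matrix m m ℂ} (hA : A.IsHermitian) (c : ℂ) :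
    (A + c • (1 : Matrix m m ℂ)).det = ∏ i, ((hA.eigenvalues i : ℂ) + c) := by
  set U : Matrix.unitaryGroup m ℂ := hA.eigenvectorUnitary
  have hD : Matrix.diagonal (RCLike.ofReal ∘ hA.eigenvalues) + c • (1 : Matrix m m ℂ) =
      Matrix.diagonal fun i => (hA.eigenvalues i : ℂ) + c := by
    rw [Matrix.smul_one_eq_diagonal, Matrix.diagonal_add]
    rfl
  have h : A + c • (1 : Matrix m m ℂ) =
      Unitary.conjStarAlgAut ℂ _ U (Matrix.diagonal (RCLike.ofReal ∘ hA.eigenvalues) + c • 1) := by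
    rw [map_add, map_smul, map_one, ← hA.spectral_theorem]
  have hU : (star U : Matrix m m ℂ).det * (U : Matrix m m ℂ).det = 1 := by
    rw [← Matrix.det_mul, Unitary.coe_star_mul_self, Matrix.det_one]
  rw [h, hD, Unitary.conjStarAlgAut_apply, Matrix.det_mul, Matrix.det_mul, Matrix.det_diagonal,
    mul_comm, ← mul_assoc, hU, one_mul]

/-- **`log ‖det(A + it)‖ = ½ Σⱼ log(λⱼ² + t²)`** over the sorted eigenvalues of `A` on `ℂᵐ`. -/
theorem log_norm_det_add_eq {A : Matrix m m ℂ} (hA : A.IsHermitian) {t : ℝ} (ht : 0 < t)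
    (hS : (Matrix.toEuclideanLin A).IsSymmetric)
    (hn : finrank ℂ (EuclideanSpace ℂ m) = Fintype.card m) :
    Real.log ‖(A + ((t : ℂ) * Complex.I) • (1 : Matrix m m ℂ)).det‖ =
      (1 / 2) * ∑ j, Real.log (hS.eigenvalues hn j ^ 2 + t ^ 2) := by
  rw [det_add_smul_one_eq hA, norm_prod, Real.log_prod fun i _ => ?_, mul_sum]
  · refine Fintype.sum_equiv (Fintype.equivOfCardEq (Fintype.card_fin _)).symm _ _ fun i => ?_
    change Real.log ‖((hS.eigenvalues hn ((Fintype.equivOfCardEq (Fintype.card_fin _)).symm i) : ℂ)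
      + (t : ℂ) * Complex.I)‖ = _
    rw [Complex.norm_add_mul_I, Real.log_sqrt (by positivity)]
    ring
  · rw [Complex.norm_add_mul_I]
    exact (Real.sqrt_pos.mpr (by positivity)).ne'

/-- `k(x) = log((x + t²)/(x + a²))` (`t ≤ a`) is monotone and `≤ 0` on `[0, ∞)`; `k(0) = −2log(a/t)`. -/
theorem log_ratio_mono {t a : ℝ} (ht : 0 < t) (hta : t ≤ a) {x y : ℝ} (hx : 0 ≤ x) (hxy : x ≤ y) :
    Real.log ((x + t ^ 2) / (x + a ^ 2)) ≤ Real.log ((y + t ^ 2) / (y + a ^ 2)) ∧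
      Real.log ((y + t ^ 2) / (y + a ^ 2)) ≤ 0 ∧
      Real.log ((0 + t ^ 2) / (0 + a ^ 2)) = -(2 * Real.log (a / t)) := by
  have ha : 0 < a := ht.trans_le hta
  have hy : 0 ≤ y := hx.trans hxy
  refine ⟨Real.log_le_log (by positivity) ?_, Real.log_nonpos (by positivity) ?_, ?_⟩
  · rw [div_le_div_iff₀ (by positivity) (by positivity)]
    nlinarith [mul_nonneg (sub_nonneg.2 hxy) (sub_nonneg.2 (pow_le_pow_left₀ ht.le hta 2))]
  · rw [div_le_one (by positivity)]
    nlinarith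
  · rw [zero_add, zero_add, ← div_pow, Real.log_pow, Real.log_div ht.ne' ha.ne',
      Real.log_div ha.ne' ht.ne']
    push_cast
    ring

/-- **Spectral shift bound for the log-determinant kernel**: for Hermitian `A`, `B` with
`rank(A − B) ≤ r` and `0 < t ≤ a`, `|D_t − D_a| ≤ 2r log(a/t)`: `log(λ²+t²) − log(λ²+a²) = φ(λ) − ψ(λ)`
with `φ(λ) = k(λ₊²) − k(0)`, `ψ(λ) = −k(λ₋²)` monotone with values in `[0, 2 log(a/t)]`. -/
theorem abs_logDetKernel_sub_le {A B : Matrix m m ℂ} (hA : A.IsHermitian) (hB : B.IsHermitian)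
    {r : ℕ} (hr : (A - B).rank ≤ r) {a t : ℝ} (ht : 0 < t) (hta : t ≤ a) :
    |logDetKernel A B t - logDetKernel A B a| ≤ 2 * r * Real.log (a / t) := by
  have ha : 0 < a := ht.trans_le hta
  have hS := Matrix.isSymmetric_toEuclideanLin_iff.mpr hA
  have hT := Matrix.isSymmetric_toEuclideanLin_iff.mpr hB
  have hn : finrank ℂ (EuclideanSpace ℂ m) = Fintype.card m := finrank_euclideanSpace
  have hr' : finrank ℂ (LinearMap.range (Matrix.toEuclideanLin A - Matrix.toEuclideanLin B))
      ≤ r := by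
    rw [← map_sub]
    exact (Matrix.rank_eq_finrank_range_toLin (A - B) (PiLp.basisFun 2 ℂ m)
      (PiLp.basisFun 2 ℂ m)).symm.trans_le hr
  set M := 2 * Real.log (a / t)
  set k : ℝ → ℝ := fun x => Real.log ((x + t ^ 2) / (x + a ^ 2))
  have hk0 : k 0 = -M := (log_ratio_mono ht hta le_rfl (le_refl 0)).2.2
  have hkm : ∀ {x}, 0 ≤ x → -M ≤ k x ∧ k x ≤ 0 := fun hx =>
    ⟨hk0 ▸ (log_ratio_mono ht hta le_rfl hx).1, (log_ratio_mono ht hta le_rfl hx).2.1⟩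
  set φ : ℝ → ℝ := fun s => k (max s 0 ^ 2) + M
  set ψ : ℝ → ℝ := fun s => -k (min s 0 ^ 2)
  have hφ : Monotone φ := fun u v huv => by
    simp only [φ, add_le_add_iff_right]
    exact (log_ratio_mono ht hta (sq_nonneg _)
      (pow_le_pow_left₀ (le_max_right _ _) (max_le_max huv le_rfl) 2)).1
  have hψ : Monotone ψ := fun u v huv => by
    simp only [ψ, neg_le_neg_iff]
    refine (log_ratio_mono ht hta (sq_nonneg _) ?_).1
    rw [← neg_sq, ← neg_sq (min u 0)]
    exact pow_le_pow_left₀ (neg_nonneg.2 (min_le_right _ _)) (neg_le_neg (min_le_min huv le_rfl)) 2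
  have hφ0 : ∀ s, 0 ≤ φ s := fun s => by simp only [φ]; linarith [(hkm (sq_nonneg (max s 0))).1]
  have hφV : ∀ s, φ s ≤ M := fun s => by simp only [φ]; linarith [(hkm (sq_nonneg (max s 0))).2]
  have hψ0 : ∀ s, 0 ≤ ψ s := fun s => by simp only [ψ]; linarith [(hkm (sq_nonneg (min s 0))).2]
  have hψV : ∀ s, ψ s ≤ M := fun s => by simp only [ψ]; linarith [(hkm (sq_nonneg (min s 0))).1]
  have e1 := abs_le.mp (abs_sum_eigenvalues_sub_le hS hT hn hr' hφ hφ0 hφV)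
  have e2 := abs_le.mp (abs_sum_eigenvalues_sub_le hS hT hn hr' hψ hψ0 hψV)
  have hh' : ∀ s, Real.log (s ^ 2 + t ^ 2) = φ s - ψ s + Real.log (s ^ 2 + a ^ 2) := by
    intro s
    rw [← sub_eq_iff_eq_add, ← Real.log_div (by positivity) (by positivity)]
    simp only [φ, ψ]
    rcases le_total s 0 with hs | hs
    · rw [max_eq_right hs, min_eq_left hs, zero_pow two_ne_zero, hk0]; ring
    · rw [max_eq_left hs, min_eq_right hs, zero_pow two_ne_zero, hk0]; ring
  have key : logDetKernel A B t - logDetKernel A B a =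
      (1 / 2) * ((∑ j, φ (hS.eigenvalues hn j) - ∑ j, φ (hT.eigenvalues hn j)) -
        (∑ j, ψ (hS.eigenvalues hn j) - ∑ j, ψ (hT.eigenvalues hn j))) := by
    simp only [logDetKernel]
    rw [log_norm_det_add_eq hA ht hS hn, log_norm_det_add_eq hB ht hT hn,
      log_norm_det_add_eq hA ha hS hn, log_norm_det_add_eq hB ha hT hn]
    simp only [hh', sum_add_distrib, sum_sub_distrib]
    ring
  rw [key, abs_le]
  constructor <;> nlinarith [e1.1, e1.2, e2.1, e2.2]

end MatrixLevel

/-! ### The vison string: Hermiticity and `rank(N_R − N_0) ≤ 4R` -/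

section Vison

variable {L : ℕ} [NeZero L]

/-- The spread hopping is symmetric in the two sites. -/
theorem visonHop_swap (R : ℕ) (u v : FermionTorus 2 L) : visonHop L R u v = visonHop L R v u := by
  unfold visonHop
  exact congrArg _ (sum_congr rfl fun i _ => add_comm _ _)

/-- The Nambu matrix of the string Hamiltonian is Hermitian (real symmetric hopping). -/
theorem isHermitian_visonNambu (μ Δ₀ : ℝ) (R : ℕ) : (visonNambu L μ Δ₀ R).IsHermitian :=
  isHermitian_bdgNambuMatrix (fun x y => by rw [visonHop_swap]; exact Complex.conj_ofReal _) _ _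

omit [NeZero L] in
/-- Without a string all signs are `+1`. -/
theorem sgn_zero_right (z : TorusSite 2 L) (i : Fin 2) : sgn L 0 z i = 1 := by
  simp [sgn]

omit [NeZero L] in
/-- Off the string sites `{(a,0),(a,1) : a < R}` every bond leaving or reaching `z` has sign `+1`. -/
theorem sgn_eq_one {R : ℕ} {z : TorusSite 2 L} (hz : ¬((z 0).val < R ∧ (z 1 = 0 ∨ z 1 = 1)))
    (i : Fin 2) : sgn L R z i = 1 ∧ ∀ w, z = w + Pi.single i 1 → sgn L R w i = 1 := by
  unfold sgn
  refine ⟨if_neg fun ⟨_, h0, hR⟩ => hz ⟨hR, Or.inl h0⟩, fun w h => if_neg fun ⟨hi, h0, hR⟩ => hz ?_⟩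
  subst hi h
  simp [h0, hR]

/-- Off the string sites the bond data of `R` and `0` agree (both orientations of the pairing). -/
theorem visonHop_visonPair_eq {R : ℕ} {x : FermionTorus 2 L}
    (hx : ¬((x.toTorusSite 0).val < R ∧ (x.toTorusSite 1 = 0 ∨ x.toTorusSite 1 = 1))) (Δ₀ : ℝ)
    (v : FermionTorus 2 L) : visonHop L R x v = visonHop L 0 x v ∧ visonPair L Δ₀ R x v =
      visonPair L Δ₀ 0 x v ∧ visonPair L Δ₀ R v x = visonPair L Δ₀ 0 v x := by
  unfold visonHop visonPair
  refine ⟨?_, ?_, ?_⟩ <;> refine congrArg _ (sum_congr rfl fun i _ => ?_) <;>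
    (try rw [(sgn_eq_one hx i).1, sgn_zero_right]) <;>
    by_cases h : x.toTorusSite = v.toTorusSite + Pi.single i 1 <;>
    simp only [h, if_true, if_false, (sgn_eq_one hx i).2, sgn_zero_right]

/-- `N_R − N_0` vanishes outside the rows of the string orbitals. -/
theorem visonNambu_sub_apply_eq_zero {μ Δ₀ : ℝ} {R : ℕ} {o : Orb (FermionTorus 2 L)}
    (ho : ¬(((ofLex o).1.toTorusSite 0).val < R ∧
      ((ofLex o).1.toTorusSite 1 = 0 ∨ (ofLex o).1.toTorusSite 1 = 1)))
    (o' : Orb (FermionTorus 2 L)) : (visonNambu L μ Δ₀ R - visonNambu L μ Δ₀ 0) o o' = 0 := by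
  obtain ⟨⟨x, σ⟩, rfl⟩ : ∃ p : FermionTorus 2 L × Fin 2, toLex p = o := ⟨ofLex o, rfl⟩
  obtain ⟨⟨y, σ'⟩, rfl⟩ : ∃ p : FermionTorus 2 L × Fin 2, toLex p = o' := ⟨ofLex o', rfl⟩
  simp only [ofLex_toLex] at ho
  obtain ⟨hxy, hpxy, hpyx⟩ := visonHop_visonPair_eq ho Δ₀ y
  have hyx : visonHop L R y x = visonHop L 0 y x := by rw [visonHop_swap, hxy, visonHop_swap]
  change (visonNambu L μ Δ₀ R - visonNambu L μ Δ₀ 0) (orb x σ) (orb y σ') = 0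
  rw [Matrix.sub_apply, visonNambu, visonNambu, bdgNambuMatrix_orb_orb, bdgNambuMatrix_orb_orb,
    hxy, hyx, hpxy, hpyx, sub_self]

/-- **`rank(N_R − N_0) ≤ 4R`**: the difference is supported on the `≤ 4R` rows of the string
orbitals `((a,0),σ)`, `((a,1),σ)`, `a < R`. -/
theorem rank_visonNambu_sub_le (μ Δ₀ : ℝ) (R : ℕ) :
    (visonNambu L μ Δ₀ R - visonNambu L μ Δ₀ 0).rank ≤ 4 * R := by
  set T : Finset (Orb (FermionTorus 2 L)) := univ.filter fun o =>
    ((ofLex o).1.toTorusSite 0).val < R ∧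
      ((ofLex o).1.toTorusSite 1 = 0 ∨ (ofLex o).1.toTorusSite 1 = 1) with hT
  set D := visonNambu L μ Δ₀ R - visonNambu L μ Δ₀ 0
  have hD : D = Matrix.diagonal (fun o => if o ∈ T then (1 : ℂ) else 0) * D := by
    ext o o'
    rw [Matrix.diagonal_mul]
    split_ifs with ho
    · rw [one_mul]
    · rw [zero_mul]
      exact visonNambu_sub_apply_eq_zero (fun h => ho (mem_filter.mpr ⟨mem_univ _, h⟩)) o'
  rw [hD]
  refine (Matrix.rank_mul_le_left _ _).trans ?_
  rw [Matrix.rank_diagonal, Fintype.card_subtype]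
  have hfil : (univ.filter fun o => (if o ∈ T then (1 : ℂ) else 0) ≠ 0) = T := by ext o; simp
  rw [hfil]
  calc T.card ≤ ((range R ×ˢ ({0, 1} : Finset (ZMod L))) ×ˢ (univ : Finset (Fin 2))).card :=
        card_le_card_of_injOn
          (fun o => ((((ofLex o).1.toTorusSite 0).val, (ofLex o).1.toTorusSite 1), (ofLex o).2))
          (fun o ho => by simpa using (mem_filter.mp ho).2)
          (fun o₁ _ o₂ _ h => by
            simp only [Prod.mk.injEq] at h
            obtain ⟨⟨h0, h1⟩, h2⟩ := h
            have htts : (ofLex o₁).1.toTorusSite = (ofLex o₂).1.toTorusSite := by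
              funext i
              fin_cases i
              exacts [ZMod.val_injective _ h0, h1]
            exact ofLex.injective (Prod.ext (FermionTorus.equivTorusSite.injective htts) h2))
    _ ≤ 4 * R := by
        rw [card_product, card_product, card_range, card_univ, Fintype.card_fin]
        nlinarith [Finset.card_le_two (a := (0 : ZMod L)) (b := 1)]

/-- **Stub `RankWindow`** of the line `Sketch`: `|D_t − D_a| ≤ 8R log(a/t)` for `0 < t ≤ a`. -/
theorem stub_rankWindow : RankWindow := by
  intro L _ _ μ Δ₀ R a t ht hta
  calc _ ≤ _ := abs_logDetKernel_sub_le (isHermitian_visonNambu (L := L) μ Δ₀ R)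
        (isHermitian_visonNambu μ Δ₀ 0) (rank_visonNambu_sub_le μ Δ₀ R) ht hta
    _ = 8 * R * Real.log (a / t) := by push_cast; ring

end Vison

end Summit.HubbardSuperconductivity.HubbardSuperconductivity.Theorems.VisonPairCost

end
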